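import Summits.ABC.ABC.Theses.DefiniteXi
import Summits.ABC.ABC.Theorems.XiBound.Negative.XiBoundDomainSetup
import Summits.ABC.ABC.Theorems.XiBound.Negative.XiBoundValueGap

/-!
# Line `max-quarantine-reduction` for crux `XiBound` (stmt-ABC-11336, route `DefiniteXi`, r2)

Crux (by name: `Summit.ABC.ABC.Theses.DefiniteXi.XiBound`):
`∃ A C, ∀` coprime `a b` with `ab(a+b) ≠ 0`, `N = N(E_(a,b))`, and every ADMISSIBLE type
`N⁻ = Nm` (odd, squarefree, `ω(Nm)` odd, `Nm ∣ N`): `ξ(E_(a,b); N/Nm, Nm) ≤ C · N^A`, where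
`ξ = brandtXi (N/Nm) Nm (a_n(E))` is the Gross/Pollack–Weston definite congruence number
(squared Gross length of the integral Jacquet–Langlands vector of `f_E` in the Brandt module of the
Eichler order of level `N/Nm` in the definite quaternion algebra of discriminant `Nm`).

## The line (crux idea card `Cruxes/XiBound/Ideas/max-quarantine-reduction.md`, triage r1 ×3)

QUARANTINE EVERYTHING.  For a Frey curve the odd part of `N` is squarefree
(`Negative.not_sq_dvd_conductorNorm_freyCurve`), so every admissible `Nm` sits inside a MAXIMAL
admissible type `M ⊇ Nm` (all odd primes of `N` but at most one; `exists_maxType` below, proved).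
Reading the Ribet–Takahashi/Pollack–Weston/Pasten identity
`η_f(N) = ξ(N/N⁻,N⁻) · ∏_{q ∣ N⁻} v_q(Δ_min) · γ_{N⁻}` at the two nested types gives

  `ξ(N/Nm, Nm) ≤ C N^B · ξ(N/M, M) · ∏_{q ∣ M/Nm} v_q(Δ_min)`      (STUB 1, known type)

and the exponent product is polynomial UNCONDITIONALLY (Pasten's product theorem, STUB 2, known),
so the crux for all `2^(ω−1)` types collapses to ONE integer per curve, `ξ_max := ξ(N/M, M)`, which
the line cuts along the residual-representation seam of Frey curves (`ρ̄_(E,ℓ)` is reducible only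
for `ℓ ∈ {2, 3}`: full rational `2`-torsion always, a rational `3`-isogeny sometimes, never a
rational `ℓ`-isogeny for `ℓ ≥ 5` — Kenku: no cyclic `4ℓ`-isogeny over `ℚ`):

  `2^(v₂ ξ_max) · 3^(v₃ ξ_max) ≤ C N^A`   (STUB 3, Eisenstein part — the live axis of the census)
  `ξ_max / (2^(v₂) 3^(v₃)) ≤ C N^A`        (STUB 4, non-Eisenstein part — abc-hard core, HARDEST).

`XiBound_of` concludes the crux BY NAME from the four registered stubs; the composition itself,
`xiBound_of_parts : RatioControl → ExponentProductBound → EisensteinPartMax → NonEisensteinPartMax →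
(XiBound unfolded)`, is kernel-checked with no `sorry`: choose `M` (`exists_maxType`), STUB 3 × STUB 4
⇒ `ξ_max ≤ C N^A` (`xiMax_le`), then STUB 1 and STUB 2 at `M/Nm` (`chain_le`).  The card's `Transfer`
(`XiMaxBound ∧ RatioControl ⇒ XiBound`) is therefore PROVED here modulo the print-known STUB 2; the
card's K1 `XiMaxBound` is recovered as `xiMaxBound_of_parts`.  Conversely STUB 3 and STUB 4 are
IMPLIED by the crux (`eisensteinPartMax_of_xiBound`, `nonEisensteinPartMax_of_xiBound`, proved):
both open stubs are necessary, nothing false can be chased that the crux itself does not assert.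

## Registered stubs (signatures fully qualified, verbatim-restateable in a Theorems file)

* `stub_ratioControl` (K2 of the card; KNOWN TYPE in print, XL formal debt — Shimura curves):
  Takahashi 2001 Thm 2.3/3.8 (`ξ(N⁺,N⁻) = h_r` of `J₀^{N⁻/r}(N⁺r)`, `δ i = h j`, `ij = c_r`) at both
  types + Pasten 2024 Thm 6.1 (`δ_{1,N}/δ_{D,M} = γ ∏_{p∣D} v_p(Δ)`, `num γ ≤ 163^ω`, and — case (a),
  `E` semistable away from `S = {2}` — `den γ ≤ κ_S^ω · D`) give
  `ξ(Nm)/ξ(M) ≤ c_r(A₁)c_r(A₂)(163κ)^ω · (Nm/r) · ∏_{q ∣ M/Nm} v_q`, i.e. the stub with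
  `B = 1 + 2·(1/3) + ε` (Stewart–Yu for `c_r ≤ v_r(Δ) ≪ N^{1/3+ε}`, Pasten L.6.8 for `c_r(A_i)/c_r(E)`).
  The 2-adic Eisenstein-cokernel risk named by the card / route corner (c) (Hamidi Thm C, `j_p > 1`)
  costs at most the factor `D ≤ N` of Pasten 6.1(a): immaterial for a POLYNOMIAL statement, so the
  stub is stated for the full integers, all primes at once (triage r1-1/r1-2 answered in the card).
  In print for squarefree `N` (2-semistable Frey curves, `16 ∣ abc` normalisation); for `4 ∣ N` the
  Buzzard/Čerednik dictionary at `2`-power level is folklore (Pasten Prop 6.13-type remark), flagged.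
* `stub_exponentProduct` (P1 of the card; KNOWN: Pasten 2024 Thm 16.8 = tree NAMED FACT
  `Literature.NumberTheory.DiophantineGeometry.pasten2024_thm_2_5`, `∏_{p∣abc} v_p(abc) ≤ κ_ε rad^{8/3+ε}`,
  with `v_q(Δ_min(E_(a,b))) ≤ 2 v_q(ab(a+b))` at odd `q` —
  `Summit.ABC.ABC.Theorems.DefiniteXiPolyFreyDegree.factorization_minimalDiscriminantNorm_freyCurve_le`
  — and `rad ∣ 2N`, `2^ω ≪ N^ε`; M-sized from the fact, closed the day the fact is discharged).
* `stub_eisensteinPartMax` (NEW, OPEN, L — the LIVE AXIS: ideator-3 census j011596/j011805 and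
  triage r1-2 j013418 put the mass of `deg φ/∏v_q` at `2` and `3`, `v₂(deg φ)/log₂N ≤ 1.29`):
  polynomial `{2,3}`-primary part of `ξ_max` = `O(log N)` depth of the congruences of `f_E` inside
  the trivial-`ρ̄₂` (and, when `E` has a rational `3`-isogeny, the reducible-`ρ̄₃`) cluster of the
  Brandt module of the (near-)MAXIMAL order (Eichler level `2^k`, `k ≤ 8`, or `2^k q₀`) — an
  Eisenstein-ideal question (Mazur; Ribet–Yoo / Yoo's Eisenstein-ideal indices at squarefree level;
  Calegari–Emerton 2005 and Wake–Wang-Erickson at `p = 2`; the Rédei-matrix lever of the sibling card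
  `two-adic-redei-depth`, whose `TwoAdicXiBound` (all types, `ℓ = 2`) implies the `ℓ = 2` half here).
* `stub_nonEisensteinPartMax` (NEW, OPEN, XL — HARDEST, the abc-hard core isolated): the
  `{2,3}`-free part of `ξ_max` is polynomial.  For every `ℓ ≥ 5`, `ρ̄_(E,ℓ)` is irreducible for every
  Frey curve, so `ℓ^{v_ℓ(ξ_max)}` is the order of the congruence module of the Steinberg-at-every-
  odd-prime deformation ring `R^{St} = 𝕋^{St}_𝔪` (Böckle–Khare–Manning arXiv:2108.09729; Wiles defect
  at trivial primes arXiv:1910.08507), the most constrained deformation problem available for `ρ_E`;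
  handles named by the card: Hida/Kim–Ota `Λ`-adic depth control prime-by-prime (arXiv:1905.02926),
  Emerton's integral Eichler basis theorem at prime level; NO lever on the support is known
  (Flach 1992 / Diamond–Flach–Guo bound the adjoint Selmer group by `L(Sym² E, 2)`, circular).

## Disproof used (payload `disproof_path` is not mounted in this jail; its docblock indexes the LANDED
modules `Summits.ABC.ABC.Theorems.XiBound.Negative.*`, two of which are imported here)

* `xiBound_iff_forall_setup` / `brandtXi_freyCurve_eq_xi` (DomainSetup) — HONOURED: every stub is
  stated with `brandtXi`; a prover may fix any Brandt setup (`example` below).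
* `nonempty_xiSetup_freyCurve`, `not_sq_dvd_conductorNorm_freyCurve` (DomainSetup) — on the crux's
  domain every admissible type, in particular the maximal type `M` produced by `exists_maxType`, is
  setup-backed (`example` below): `ξ_max` in STUBS 3/4 is the genuine congruence number, not junk.
* `xiBound_iff_dropParityAndSquarefree` — consistent: the guards are kept verbatim in every stub.
* `xiBound_violators_infinite` / `not_xiBound_iff` (Locks) — every stub is an `∃`-constants
  statement; no finite census refutes any of them (the card's fixed-shape predictions live in the
  line card, §Cheapest falsifier).
* `not_xiBound_of_superpolynomial_optimal_degrees`, `xi_le_modularDegree_mul_ord` (TakahashiSqueeze)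
  — consistent: STUB 1 is the two-type version of the same squeeze; STUBS 3 ∧ 4 ⟺ `XiMaxBound`
  ⟺ polynomial optimal degree modulo the PROVED `∏ v_q` (the card's thesis).
* `not_xiBound_twoSided_dropParity` — irrelevant: no lower bound on `ξ` is asserted anywhere
  (STUB 1 uses `ξ(M)` only as an UPPER bound for `ξ(Nm)`; its implicit content "`ξ(M) ≠ 0` whenever
  `ξ(Nm) ≠ 0`" is Jacquet–Langlands + multiplicity one at the maximal type, true).
* `brandtXi_lFunction_ne_one` (ValueGap) — harmless (`example` below).
No `_false_without_` theorem exists for this crux (cdisprove verdict "resists"); no stub is an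
instance of a landed Negative lemma; `ledger negatives --problem ABC` (2 entries:
GlobalQuasiLogDerivative, BelyiSqueeze) is unrelated.

Planner seat `planner-cruxplan-stmt-ABC-11336-max-quarantine-reduc-0`, 2026-08-16 (round 1).
-/

-- `Summit.<Summit>.<Problem>`: for the single-conjunct summit `ABC` the duplicate `ABC.ABC` is mandated.
set_option linter.dupNamespace false

noncomputable section

namespace Summit.ABC.ABC.Cruxes.XiBound.MaxQuarantineReduction

open scoped BigOperators
open Literature.NumberTheory.Automorphic Literature.NumberTheory.EllipticCurves

/-! ### Vocabulary of the line (named `Prop`s; the registered stubs below restate them verbatim) -/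

/-- The Brandt eigenvalue system of the Frey curve `E_(a,b)`: `n ↦ a_n(E)`. -/
def lam (a b : ℤ) : ℕ → ℤ := fun n => (freyCurve a b).LFunction n

/-- `M` is a MAXIMAL type for `N`: at most one odd prime of `N` is left outside `M`. -/
def IsMaxType (N M : ℕ) : Prop :=
  (N.primeFactors.filter fun q => q ≠ 2 ∧ ¬ q ∣ M).card ≤ 1

/-- The `{2,3}`-primary part `2^(v₂ n) · 3^(v₃ n)` of a natural number (`= 1` for `n = 0`). -/
def sixPart (n : ℕ) : ℕ := 2 ^ n.factorization 2 * 3 ^ n.factorization 3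

/-- **STUB 1 statement — `RatioControl`** (K2 of the card): between two nested admissible types
`Nm ∣ M` of the same Frey curve, `ξ(N/Nm, Nm) ≤ C N^B · ξ(N/M, M) · ∏_{q ∣ M/Nm} v_q(Δ_min)`. -/
def RatioControl : Prop :=
  ∃ B C : ℝ, ∀ a b : ℤ, IsCoprime a b → a * b * (a + b) ≠ 0 → ∀ (N : ℕ) [NeZero N],
    (freyCurve a b).conductorNorm ℤ = N → ∀ Nm M : ℕ,
    Odd Nm → Squarefree Nm → Odd Nm.primeFactors.card → Nm ∣ N →
    Odd M → Squarefree M → Odd M.primeFactors.card → M ∣ N → Nm ∣ M →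
    (brandtXi (N / Nm) Nm (fun n => (freyCurve a b).LFunction n) : ℝ) ≤
      C * (N : ℝ) ^ B * (brandtXi (N / M) M (fun n => (freyCurve a b).LFunction n) : ℝ) *
        ∏ q ∈ (M / Nm).primeFactors,
          ((((freyCurve a b).minimalDiscriminantNorm ℤ).factorization q : ℕ) : ℝ)

/-- **STUB 2 statement — `ExponentProductBound`** (P1 of the card, Pasten's product theorem on Frey
curves): for odd squarefree `M ∣ N`, `∏_{q ∣ M} v_q(Δ_min(E_(a,b))) ≤ C N^B`. -/
def ExponentProductBound : Prop :=
  ∃ B C : ℝ, ∀ a b : ℤ, IsCoprime a b → a * b * (a + b) ≠ 0 → ∀ (N : ℕ) [NeZero N],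
    (freyCurve a b).conductorNorm ℤ = N → ∀ M : ℕ, Odd M → Squarefree M → M ∣ N →
    (∏ q ∈ M.primeFactors,
        ((((freyCurve a b).minimalDiscriminantNorm ℤ).factorization q : ℕ) : ℝ)) ≤ C * (N : ℝ) ^ B

/-- **STUB 3 statement — `EisensteinPartMax`**: at a maximal admissible type `M`, the `{2,3}`-primary
part of `ξ_max = ξ(N/M, M)` is polynomial in `N` (equivalently `v₂(ξ_max), v₃(ξ_max) = O(log N)`). -/
def EisensteinPartMax : Prop :=
  ∃ A C : ℝ, ∀ a b : ℤ, IsCoprime a b → a * b * (a + b) ≠ 0 → ∀ (N : ℕ) [NeZero N],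
    (freyCurve a b).conductorNorm ℤ = N → ∀ M : ℕ,
    Odd M → Squarefree M → Odd M.primeFactors.card → M ∣ N →
    (N.primeFactors.filter fun q => q ≠ 2 ∧ ¬ q ∣ M).card ≤ 1 →
    ((2 ^ (brandtXi (N / M) M fun n => (freyCurve a b).LFunction n).factorization 2 *
        3 ^ (brandtXi (N / M) M fun n => (freyCurve a b).LFunction n).factorization 3 : ℕ) : ℝ) ≤
      C * (N : ℝ) ^ A

/-- **STUB 4 statement — `NonEisensteinPartMax`**: at a maximal admissible type `M`, the
`{2,3}`-free part `ξ_max / (2^(v₂) 3^(v₃))` of `ξ_max` is polynomial in `N`. -/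
def NonEisensteinPartMax : Prop :=
  ∃ A C : ℝ, ∀ a b : ℤ, IsCoprime a b → a * b * (a + b) ≠ 0 → ∀ (N : ℕ) [NeZero N],
    (freyCurve a b).conductorNorm ℤ = N → ∀ M : ℕ,
    Odd M → Squarefree M → Odd M.primeFactors.card → M ∣ N →
    (N.primeFactors.filter fun q => q ≠ 2 ∧ ¬ q ∣ M).card ≤ 1 →
    (((brandtXi (N / M) M fun n => (freyCurve a b).LFunction n) /
        (2 ^ (brandtXi (N / M) M fun n => (freyCurve a b).LFunction n).factorization 2 *
          3 ^ (brandtXi (N / M) M fun n => (freyCurve a b).LFunction n).factorization 3) : ℕ) : ℝ) ≤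
      C * (N : ℝ) ^ A

/-- The card's K1, `XiMaxBound`: `ξ_max ≤ C N^A` at every maximal admissible type (derived below from
STUBS 3 and 4; kept as the line's pivot statement). -/
def XiMaxBound : Prop :=
  ∃ A C : ℝ, ∀ a b : ℤ, IsCoprime a b → a * b * (a + b) ≠ 0 → ∀ (N : ℕ) [NeZero N],
    (freyCurve a b).conductorNorm ℤ = N → ∀ M : ℕ,
    Odd M → Squarefree M → Odd M.primeFactors.card → M ∣ N →
    (N.primeFactors.filter fun q => q ≠ 2 ∧ ¬ q ∣ M).card ≤ 1 →
    (brandtXi (N / M) M (fun n => (freyCurve a b).LFunction n) : ℝ) ≤ C * (N : ℝ) ^ A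

/-! ### Registered stubs (`theorem stub_… := by sorry`; the ONLY sorries of this file) -/

/-- **STUB 1 — `stub_ratioControl`** (KNOWN TYPE in print; XL formal debt).  Between two nested
admissible types `Nm ∣ M` of the Frey curve `E_(a,b)` (conductor `N`):
`ξ(N/Nm, Nm) ≤ C · N^B · ξ(N/M, M) · ∏_{q ∣ M/Nm} v_q(Δ_min(E_(a,b)))`.
In print (squarefree `N`): Takahashi 2001 Thm 2.3 + 3.8 at a prime `r ∣ Nm` for the Shimura curves
`X₀^{Nm/r}((N/Nm)·r)` and `X₀^{M/r}((N/M)·r)` (`δ i = h j`, `i j = c_r`, `h = ξ`), Pasten 2024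
Thm 6.1 (`δ_{1,N} = γ ∏_{p∣D} v_p(Δ) · δ_{D,M'}`, `num γ ≤ 163^{ω(D)}`, `den γ ≤ κ_{2}^{ω(D)} D` for
curves semistable away from `2`) and Lemma 6.8 (`c_r` across an isogeny: height `≤ 163`) give the
bound with `C N^B = 163² c_r(E)² (163 κ)^{ω(N)} · Nm`, polynomial by `c_r(E) = v_r(Δ_min) ≪ N^{1/3+ε}`
(Stewart–Yu; `≤ N^{15}·const` by the tree's Stewart–Tijdeman) and `C^{ω(N)} ≪ N^ε`.  Why it might
fail: only through the `2`-power-level (`4 ∣ N`) extension of the Buzzard/Ribet dictionary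
`X_r(J₀^D(M')) ≅ ℤ[Cls O]⁰`, not in print verbatim; every Eisenstein-prime loss is absorbed by `N^B`. -/
theorem stub_ratioControl :
    ∃ B C : ℝ, ∀ a b : ℤ, IsCoprime a b → a * b * (a + b) ≠ 0 → ∀ (N : ℕ) [NeZero N],
      (Literature.NumberTheory.EllipticCurves.freyCurve a b).conductorNorm ℤ = N → ∀ Nm M : ℕ,
      Odd Nm → Squarefree Nm → Odd Nm.primeFactors.card → Nm ∣ N →
      Odd M → Squarefree M → Odd M.primeFactors.card → M ∣ N → Nm ∣ M →
      (Literature.NumberTheory.Automorphic.brandtXi (N / Nm) Nm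
          (fun n => (Literature.NumberTheory.EllipticCurves.freyCurve a b).LFunction n) : ℝ) ≤
        C * (N : ℝ) ^ B *
          (Literature.NumberTheory.Automorphic.brandtXi (N / M) M
            (fun n => (Literature.NumberTheory.EllipticCurves.freyCurve a b).LFunction n) : ℝ) *
          ∏ q ∈ (M / Nm).primeFactors,
            ((((Literature.NumberTheory.EllipticCurves.freyCurve a b).minimalDiscriminantNorm
                ℤ).factorization q : ℕ) : ℝ) := by
  sorry

/-- **STUB 2 — `stub_exponentProduct`** (KNOWN: Pasten 2024 Thm 16.8; M-sized from the tree's named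
fact `Literature.NumberTheory.DiophantineGeometry.pasten2024_thm_2_5`).  For the Frey curve
`E_(a,b)` of conductor `N` and every ODD squarefree `M ∣ N`:
`∏_{q ∣ M} v_q(Δ_min(E_(a,b))) ≤ C · N^B` (print: `B = 8/3 + ε`).  Route: at odd `q`,
`v_q(Δ_min) ≤ 2 v_q(ab(a+b))` (tree theorem
`Summit.ABC.ABC.Theorems.DefiniteXiPolyFreyDegree.factorization_minimalDiscriminantNorm_freyCurve_le`),
so the product is `≤ 2^{ω(M)} ∏_{p ∣ abc} v_p(abc) ≤ 2^ω κ_ε rad(abc)^{8/3+ε}` for the abc triple made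
of `|a|, |b|, |a+b|`, and `rad ∣ 2N` (`radical_natAbs_dvd_two_mul_conductorNorm_freyCurve`),
`2^{ω(N)} ≪ N^ε`.  Why it might fail: it cannot (theorem in print); formal debt = the named fact. -/
theorem stub_exponentProduct :
    ∃ B C : ℝ, ∀ a b : ℤ, IsCoprime a b → a * b * (a + b) ≠ 0 → ∀ (N : ℕ) [NeZero N],
      (Literature.NumberTheory.EllipticCurves.freyCurve a b).conductorNorm ℤ = N → ∀ M : ℕ,
      Odd M → Squarefree M → M ∣ N →
      (∏ q ∈ M.primeFactors,
          ((((Literature.NumberTheory.EllipticCurves.freyCurve a b).minimalDiscriminantNorm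
              ℤ).factorization q : ℕ) : ℝ)) ≤ C * (N : ℝ) ^ B := by
  sorry

/-- **STUB 3 — `stub_eisensteinPartMax`** (NEW, OPEN, size L; the live axis).  For the Frey curve
`E_(a,b)` of conductor `N` and every MAXIMAL admissible type `M` (odd, squarefree, `ω(M)` odd,
`M ∣ N`, at most one odd prime of `N` outside `M`), the `{2,3}`-primary part of
`ξ_max = brandtXi (N/M) M (a_n(E))` is at most `C · N^A`; i.e. the `2`- and `3`-adic DEPTHS of the
congruences satisfied by the Jacquet–Langlands vector of `f_E` on the definite algebra of
discriminant `M` (Eichler level `N/M = 2^k` or `2^k q₀`) are `O(log N)`.  Eisenstein at `2` for every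
Frey curve (`E[2] ⊂ E(ℚ)`), at `3` exactly when `E` has a rational `3`-isogeny.  Why it might fail:
only if a family of abc triples drives `v₂(ξ_max)` (or `v₃`) superlogarithmically — then `XiBound`
and polynomial Szpiro on Frey curves fail too (the stub is implied by the crux:
`eisensteinPartMax_of_xiBound`).  Census: `v₂(deg φ)/log₂ N ≤ 1.29` on Mersenne/Fermat families
(kit j013418), `≤ 0.93` on 175 curves `N ≤ 5520` (j007442). -/
theorem stub_eisensteinPartMax :
    ∃ A C : ℝ, ∀ a b : ℤ, IsCoprime a b → a * b * (a + b) ≠ 0 → ∀ (N : ℕ) [NeZero N],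
      (Literature.NumberTheory.EllipticCurves.freyCurve a b).conductorNorm ℤ = N → ∀ M : ℕ,
      Odd M → Squarefree M → Odd M.primeFactors.card → M ∣ N →
      (N.primeFactors.filter fun q => q ≠ 2 ∧ ¬ q ∣ M).card ≤ 1 →
      ((2 ^ (Literature.NumberTheory.Automorphic.brandtXi (N / M) M fun n =>
              (Literature.NumberTheory.EllipticCurves.freyCurve a b).LFunction n).factorization 2 *
          3 ^ (Literature.NumberTheory.Automorphic.brandtXi (N / M) M fun n =>
              (Literature.NumberTheory.EllipticCurves.freyCurve a b).LFunction n).factorization 3 :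
            ℕ) : ℝ) ≤ C * (N : ℝ) ^ A := by
  sorry

/-- **STUB 4 — `stub_nonEisensteinPartMax`** (NEW, OPEN, size XL; HARDEST — the abc-hard core,
isolated).  For the Frey curve `E_(a,b)` of conductor `N` and every MAXIMAL admissible type `M`, the
`{2,3}`-free part `ξ_max / (2^{v₂ ξ_max} 3^{v₃ ξ_max})` of `ξ_max = brandtXi (N/M) M (a_n(E))` is at
most `C · N^A`.  For every prime `ℓ ≥ 5`, `ρ̄_(E,ℓ)` is irreducible for every Frey curve (a rational
`ℓ`-isogeny together with the full rational `2`-torsion would give a rational cyclic `4ℓ`-isogeny on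
a `2`-isogenous curve, excluded by Kenku), so the `ℓ`-part counted here is the congruence module of
the Steinberg-at-every-odd-prime deformation ring `R^{St}_(ρ̄_(E,ℓ)) = 𝕋^{St}_𝔪` (Böckle–Khare–
Manning): `XiBound` restricted to the one type and the one residual regime where modularity lifting
applies.  Why it might fail: false iff an abc family has superpolynomial odd non-Eisenstein
`ξ_max` (then polynomial Szpiro fails on Frey curves); implied by the crux
(`nonEisensteinPartMax_of_xiBound`); no finite census bears on it. -/
theorem stub_nonEisensteinPartMax :
    ∃ A C : ℝ, ∀ a b : ℤ, IsCoprime a b → a * b * (a + b) ≠ 0 → ∀ (N : ℕ) [NeZero N],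
      (Literature.NumberTheory.EllipticCurves.freyCurve a b).conductorNorm ℤ = N → ∀ M : ℕ,
      Odd M → Squarefree M → Odd M.primeFactors.card → M ∣ N →
      (N.primeFactors.filter fun q => q ≠ 2 ∧ ¬ q ∣ M).card ≤ 1 →
      (((Literature.NumberTheory.Automorphic.brandtXi (N / M) M fun n =>
              (Literature.NumberTheory.EllipticCurves.freyCurve a b).LFunction n) /
          (2 ^ (Literature.NumberTheory.Automorphic.brandtXi (N / M) M fun n =>
                (Literature.NumberTheory.EllipticCurves.freyCurve a b).LFunction n).factorization 2 *
            3 ^ (Literature.NumberTheory.Automorphic.brandtXi (N / M) M fun n =>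
                (Literature.NumberTheory.EllipticCurves.freyCurve a b).LFunction n).factorization 3) :
            ℕ) : ℝ) ≤ C * (N : ℝ) ^ A := by
  sorry

/-! ### Consistency: each named statement IS its registered stub (definitionally) -/

theorem ratioControl_holds : RatioControl := stub_ratioControl
theorem exponentProductBound_holds : ExponentProductBound := stub_exponentProduct
theorem eisensteinPartMax_holds : EisensteinPartMax := stub_eisensteinPartMax
theorem nonEisensteinPartMax_holds : NonEisensteinPartMax := stub_nonEisensteinPartMax

/-! ### Bookkeeping I: the maximal admissible type containing a given admissible type (PROVED) -/

/-- A product of distinct primes is squarefree. -/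
theorem squarefree_prod_of_primes (S : Finset ℕ) (hS : ∀ p ∈ S, p.Prime) :
    Squarefree (∏ p ∈ S, p) := by
  classical
  induction S using Finset.induction_on with
  | empty => simp
  | insert p S hp ih =>
    rw [Finset.prod_insert hp, Nat.squarefree_mul_iff]
    have hpP : p.Prime := hS p (Finset.mem_insert_self p S)
    have hS' : ∀ q ∈ S, q.Prime := fun q hq => hS q (Finset.mem_insert_of_mem hq)
    refine ⟨Nat.Coprime.prod_right fun q hq => (Nat.coprime_primes hpP (hS' q hq)).2 ?_,
      hpP.squarefree, ih hS'⟩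
    rintro rfl
    exact hp hq

/-- A product of odd numbers is odd. -/
theorem odd_prod {S : Finset ℕ} (hS : ∀ p ∈ S, Odd p) : Odd (∏ p ∈ S, p) :=
  Finset.prod_induction (fun p => p) Odd (fun _ _ ha hb => ha.mul hb) odd_one hS

/-- **Existence of the maximal type.**  If `Nm` is an admissible type for `N ≠ 0` (odd, squarefree,
`ω(Nm)` odd, `Nm ∣ N`), there is an admissible `M` with `Nm ∣ M ∣ N` leaving at most ONE odd prime of
`N` outside: `M = ∏` (odd primes of `N`) if their number is odd, else that product with one odd prime
`q₀ ∤ Nm` removed (it exists because `ω(Nm)` is odd).  No squarefreeness of `N` is needed. -/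
theorem exists_maxType {N Nm : ℕ} (hN : N ≠ 0) (hodd : Odd Nm) (hsq : Squarefree Nm)
    (hcard : Odd Nm.primeFactors.card) (hdvd : Nm ∣ N) :
    ∃ M : ℕ, Odd M ∧ Squarefree M ∧ Odd M.primeFactors.card ∧ M ∣ N ∧
      (N.primeFactors.filter fun q => q ≠ 2 ∧ ¬ q ∣ M).card ≤ 1 ∧ Nm ∣ M := by
  classical
  -- the odd primes of `N` and the primes of `Nm`
  set P : Finset ℕ := N.primeFactors.filter fun q => q ≠ 2 with hPdef
  set Q : Finset ℕ := Nm.primeFactors with hQdef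
  have hPprime : ∀ p ∈ P, p.Prime := fun p hp =>
    Nat.prime_of_mem_primeFactors (Finset.mem_filter.mp hp).1
  have hQP : Q ⊆ P := by
    intro q hq
    have hq' := Nat.mem_primeFactors.mp hq
    refine Finset.mem_filter.mpr ⟨Nat.mem_primeFactors.mpr ⟨hq'.1, hq'.2.1.trans hdvd, hN⟩, ?_⟩
    rintro rfl
    exact (Nat.not_even_iff_odd.mpr hodd) (even_iff_two_dvd.mpr hq'.2.1)
  -- choose the prime set `P'` of `M`
  obtain ⟨P', hQP', hP'P, hP'odd, hdiff⟩ :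
      ∃ P' : Finset ℕ, Q ⊆ P' ∧ P' ⊆ P ∧ Odd P'.card ∧ (P \ P').card ≤ 1 := by
    by_cases hP : Odd P.card
    · exact ⟨P, hQP, Finset.Subset.refl P, hP, by simp⟩
    · have hne : (P \ Q).Nonempty := by
        rw [Finset.sdiff_nonempty]
        intro hPQ
        have hEQ : P = Q := Finset.Subset.antisymm hPQ hQP
        exact hP (by rw [hEQ]; exact hcard)
      obtain ⟨q₀, hq₀⟩ := hne
      rw [Finset.mem_sdiff] at hq₀
      refine ⟨P.erase q₀, fun q hq => Finset.mem_erase.mpr ⟨?_, hQP hq⟩, Finset.erase_subset _ _,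
        ?_, ?_⟩
      · rintro rfl
        exact hq₀.2 hq
      · rw [Finset.card_erase_of_mem hq₀.1]
        have h1 : 1 ≤ P.card := Finset.card_pos.mpr ⟨q₀, hq₀.1⟩
        obtain ⟨k, hk⟩ := Nat.not_odd_iff_even.mp hP
        exact ⟨k - 1, by omega⟩
      · refine Finset.card_le_one.mpr fun x hx y hy => ?_
        rw [Finset.mem_sdiff, Finset.mem_erase, not_and_or, not_ne_iff] at hx hy
        have hx' : x = q₀ := by
          rcases hx.2 with h | h
          · exact h
          · exact absurd hx.1 h
        have hy' : y = q₀ := by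
          rcases hy.2 with h | h
          · exact h
          · exact absurd hy.1 h
        rw [hx', hy']
  have hP'prime : ∀ p ∈ P', p.Prime := fun p hp => hPprime p (hP'P hp)
  refine ⟨∏ p ∈ P', p, ?_, squarefree_prod_of_primes P' hP'prime, ?_, ?_, ?_, ?_⟩
  · -- odd
    exact odd_prod fun p hp => (hP'prime p hp).odd_of_ne_two (Finset.mem_filter.mp (hP'P hp)).2
  · -- `ω(M) = #P'` is odd
    rw [Nat.primeFactors_prod hP'prime]
    exact hP'odd
  · -- `M ∣ N`
    exact Finset.prod_primes_dvd N (fun p hp => (hP'prime p hp).prime) fun p hp =>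
      Nat.dvd_of_mem_primeFactors (Finset.mem_filter.mp (hP'P hp)).1
  · -- maximality: an odd prime of `N` not dividing `M` lies in `P \ P'`
    refine le_trans (Finset.card_le_card fun q hq => ?_) hdiff
    rw [Finset.mem_filter] at hq
    refine Finset.mem_sdiff.mpr ⟨Finset.mem_filter.mpr ⟨hq.1, hq.2.1⟩, fun hqP' => hq.2.2 ?_⟩
    exact Finset.dvd_prod_of_mem (fun p => p) hqP'
  · -- `Nm ∣ M`
    rw [← Nat.prod_primeFactors_of_squarefree hsq]
    exact Finset.prod_dvd_prod_of_subset _ _ _ hQP'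

/-! ### Bookkeeping II: the `{2,3}`-primary part and the real arithmetic (PROVED) -/

/-- `2^(v₂ n) 3^(v₃ n) ∣ n`. -/
theorem sixPart_dvd (n : ℕ) : sixPart n ∣ n := by
  rcases eq_or_ne n 0 with rfl | hn
  · exact dvd_zero _
  · have hcop : Nat.Coprime (2 ^ n.factorization 2) (3 ^ n.factorization 3) :=
      Nat.Coprime.pow _ _ (by norm_num)
    exact hcop.mul_dvd_of_dvd_of_dvd (Nat.ordProj_dvd n 2) (Nat.ordProj_dvd n 3)

/-- `n = (2^(v₂ n) 3^(v₃ n)) · (n / (2^(v₂ n) 3^(v₃ n)))`. -/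
theorem sixPart_mul_div (n : ℕ) : sixPart n * (n / sixPart n) = n :=
  Nat.mul_div_cancel' (sixPart_dvd n)

/-- `1 ≤ 2^(v₂ n) 3^(v₃ n)`. -/
theorem one_le_sixPart (n : ℕ) : 1 ≤ sixPart n :=
  Nat.one_le_iff_ne_zero.mpr (Nat.mul_ne_zero (pow_ne_zero _ two_ne_zero)
    (pow_ne_zero _ three_ne_zero))

/-- STUB 3 × STUB 4 at one integer: `ξ = sixPart ξ · (ξ / sixPart ξ) ≤ (C₃ N^{A₃})(C₄ N^{A₄})`. -/
theorem xiMax_le {ξ : ℕ} {N C₃ A₃ C₄ A₄ : ℝ} (hN : 0 < N) (hC₃ : 0 ≤ C₃)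
    (h3 : (sixPart ξ : ℝ) ≤ C₃ * N ^ A₃) (h4 : ((ξ / sixPart ξ : ℕ) : ℝ) ≤ C₄ * N ^ A₄) :
    (ξ : ℝ) ≤ C₃ * C₄ * N ^ (A₃ + A₄) := by
  have hsplit : (ξ : ℝ) = (sixPart ξ : ℝ) * ((ξ / sixPart ξ : ℕ) : ℝ) := by
    rw [← Nat.cast_mul, sixPart_mul_div]
  rw [hsplit, Real.rpow_add hN]
  calc (sixPart ξ : ℝ) * ((ξ / sixPart ξ : ℕ) : ℝ)
      ≤ (C₃ * N ^ A₃) * (C₄ * N ^ A₄) :=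
        mul_le_mul h3 h4 (Nat.cast_nonneg _) (mul_nonneg hC₃ (Real.rpow_nonneg hN.le _))
    _ = C₃ * C₄ * (N ^ A₃ * N ^ A₄) := by ring

/-- STUB 1 · (bound on `ξ(M)`) · STUB 2: `ξ₁ ≤ C₁N^{B₁} ξ₂ P`, `ξ₂ ≤ C_M N^{A_M}`, `P ≤ C₂ N^{B₂}`
give `ξ₁ ≤ C₁ C_M C₂ N^{B₁ + A_M + B₂}`. -/
theorem chain_le {ξ₁ ξ₂ P N C₁ B₁ C₂ B₂ CM AM : ℝ} (hN : 0 < N) (hC₁ : 0 ≤ C₁) (hP : 0 ≤ P)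
    (hCM : 0 ≤ CM) (h1 : ξ₁ ≤ C₁ * N ^ B₁ * ξ₂ * P) (hM : ξ₂ ≤ CM * N ^ AM)
    (h2 : P ≤ C₂ * N ^ B₂) :
    ξ₁ ≤ C₁ * CM * C₂ * N ^ (B₁ + AM + B₂) := by
  have hNB : 0 ≤ N ^ B₁ := Real.rpow_nonneg hN.le _
  have hNA : 0 ≤ N ^ AM := Real.rpow_nonneg hN.le _
  calc ξ₁ ≤ C₁ * N ^ B₁ * ξ₂ * P := h1
    _ ≤ C₁ * N ^ B₁ * (CM * N ^ AM) * (C₂ * N ^ B₂) := by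
        refine mul_le_mul ?_ h2 hP ?_
        · exact mul_le_mul_of_nonneg_left hM (mul_nonneg hC₁ hNB)
        · exact mul_nonneg (mul_nonneg hC₁ hNB) (mul_nonneg hCM hNA)
    _ = C₁ * CM * C₂ * (N ^ B₁ * N ^ AM * N ^ B₂) := by ring
    _ = C₁ * CM * C₂ * N ^ (B₁ + AM + B₂) := by rw [Real.rpow_add hN, Real.rpow_add hN]

/-! ### The card's K1 recovered: STUBS 3 ∧ 4 ⇒ `XiMaxBound` (PROVED) -/

/-- **`XiMaxBound` from its two slices** (Eisenstein part × non-Eisenstein part). -/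
theorem xiMaxBound_of_parts (h3 : EisensteinPartMax) (h4 : NonEisensteinPartMax) : XiMaxBound := by
  obtain ⟨A₃, C₃, H3⟩ := h3
  obtain ⟨A₄, C₄, H4⟩ := h4
  refine ⟨A₃ + A₄, max C₃ 0 * max C₄ 0, fun a b hab h0 N _ hN M hMo hMs hMc hMN hMmax => ?_⟩
  have hNpos : (0 : ℝ) < N := by exact_mod_cast Nat.pos_of_ne_zero (NeZero.ne N)
  have e3 := H3 a b hab h0 N hN M hMo hMs hMc hMN hMmax
  have e4 := H4 a b hab h0 N hN M hMo hMs hMc hMN hMmax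
  have e3' : (sixPart (brandtXi (N / M) M fun n => (freyCurve a b).LFunction n) : ℝ) ≤
      max C₃ 0 * (N : ℝ) ^ A₃ :=
    e3.trans (mul_le_mul_of_nonneg_right (le_max_left _ _) (Real.rpow_nonneg hNpos.le _))
  have e4' : (((brandtXi (N / M) M fun n => (freyCurve a b).LFunction n) /
      sixPart (brandtXi (N / M) M fun n => (freyCurve a b).LFunction n) : ℕ) : ℝ) ≤
      max C₄ 0 * (N : ℝ) ^ A₄ :=
    e4.trans (mul_le_mul_of_nonneg_right (le_max_left _ _) (Real.rpow_nonneg hNpos.le _))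
  exact xiMax_le hNpos (le_max_right _ _) e3' e4'

/-! ### The composition: the four statements imply the crux (no `sorry` here) -/

/-- **The reduction, closed form** — `RatioControl → ExponentProductBound → EisensteinPartMax →
NonEisensteinPartMax → XiBound`, stated with the crux UNFOLDED verbatim (so that `XiBound_of` below is
the only theorem of the file concluding the route decl by name; the `example` after it certifies that
this conclusion IS `Summit.ABC.ABC.Theses.DefiniteXi.XiBound`).  Proof: for an admissible `Nm` choose a
maximal admissible `M ⊇ Nm` (`exists_maxType`); STUB 1 bounds `ξ(N/Nm,Nm)` by
`C₁N^{B₁} · ξ(N/M,M) · ∏_{q∣M/Nm} v_q`; STUBS 3 × 4 bound `ξ(N/M,M)` (`xiMaxBound_of_parts`); STUB 2 at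
the odd squarefree `M/Nm ∣ N` bounds the product; constants are made non-negative and multiplied
(`chain_le`).  Exponent `A = B₁ + (A₃ + A₄) + B₂`. -/
theorem xiBound_of_parts (h1 : RatioControl) (h2 : ExponentProductBound) (h3 : EisensteinPartMax)
    (h4 : NonEisensteinPartMax) :
    ∃ A C : ℝ, ∀ a b : ℤ, IsCoprime a b → a * b * (a + b) ≠ 0 → ∀ (N : ℕ) [NeZero N],
      (freyCurve a b).conductorNorm ℤ = N → ∀ Nm : ℕ, Odd Nm → Squarefree Nm →
      Odd Nm.primeFactors.card → Nm ∣ N →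
      (brandtXi (N / Nm) Nm (fun n => (freyCurve a b).LFunction n) : ℝ) ≤ C * (N : ℝ) ^ A := by
  obtain ⟨AM, CM, HM⟩ := xiMaxBound_of_parts h3 h4
  obtain ⟨B₁, C₁, H1⟩ := h1
  obtain ⟨B₂, C₂, H2⟩ := h2
  refine ⟨B₁ + AM + B₂, max C₁ 0 * max CM 0 * max C₂ 0, ?_⟩
  intro a b hab h0 N _ hN Nm hodd hsq hcard hdvd
  have hN0 : N ≠ 0 := NeZero.ne N
  have hNpos : (0 : ℝ) < N := by exact_mod_cast Nat.pos_of_ne_zero hN0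
  obtain ⟨M, hMo, hMs, hMc, hMN, hMmax, hNmM⟩ := exists_maxType hN0 hodd hsq hcard hdvd
  -- STUB 1 between `Nm` and `M`
  have e1 := H1 a b hab h0 N hN Nm M hodd hsq hcard hdvd hMo hMs hMc hMN hNmM
  -- `ξ(M)` is polynomial (STUBS 3, 4)
  have eM := HM a b hab h0 N hN M hMo hMs hMc hMN hMmax
  -- STUB 2 at the odd squarefree `M / Nm ∣ N`
  have hMNm : Nm * (M / Nm) = M := Nat.mul_div_cancel' hNmM
  have hMo' : Odd (Nm * (M / Nm)) := by rw [hMNm]; exact hMo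
  have hqo : Odd (M / Nm) := (Nat.odd_mul.mp hMo').2
  have hqs : Squarefree (M / Nm) := Squarefree.squarefree_of_dvd (Nat.div_dvd_of_dvd hNmM) hMs
  have hqN : M / Nm ∣ N := (Nat.div_dvd_of_dvd hNmM).trans hMN
  have e2 := H2 a b hab h0 N hN (M / Nm) hqo hqs hqN
  -- abbreviations
  set ξ₁ : ℝ := (brandtXi (N / Nm) Nm (fun n => (freyCurve a b).LFunction n) : ℝ)
  set ξ₂ : ℝ := (brandtXi (N / M) M (fun n => (freyCurve a b).LFunction n) : ℝ)
  set P : ℝ := ∏ q ∈ (M / Nm).primeFactors,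
    ((((freyCurve a b).minimalDiscriminantNorm ℤ).factorization q : ℕ) : ℝ)
  have hξ₂nn : 0 ≤ ξ₂ := Nat.cast_nonneg _
  have hPnn : 0 ≤ P := Finset.prod_nonneg fun q _ => Nat.cast_nonneg _
  have hNB : 0 ≤ (N : ℝ) ^ B₁ := Real.rpow_nonneg hNpos.le _
  -- make the constants non-negative
  have e1' : ξ₁ ≤ max C₁ 0 * (N : ℝ) ^ B₁ * ξ₂ * P := by
    refine e1.trans ?_
    have : C₁ * (N : ℝ) ^ B₁ * ξ₂ * P ≤ max C₁ 0 * (N : ℝ) ^ B₁ * ξ₂ * P :=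
      mul_le_mul_of_nonneg_right (mul_le_mul_of_nonneg_right
        (mul_le_mul_of_nonneg_right (le_max_left _ _) hNB) hξ₂nn) hPnn
    exact this
  have eM' : ξ₂ ≤ max CM 0 * (N : ℝ) ^ AM :=
    eM.trans (mul_le_mul_of_nonneg_right (le_max_left _ _) (Real.rpow_nonneg hNpos.le _))
  have e2' : P ≤ max C₂ 0 * (N : ℝ) ^ B₂ :=
    e2.trans (mul_le_mul_of_nonneg_right (le_max_left _ _) (Real.rpow_nonneg hNpos.le _))
  exact chain_le hNpos (le_max_right _ _) hPnn (le_max_right _ _) e1' eM' e2'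

/-- **Skeleton theorem — `XiBound` BY NAME from the four registered stubs** (kernel-checked; the
only `sorry`s in its closure are the four stubs themselves). -/
theorem XiBound_of : Summit.ABC.ABC.Theses.DefiniteXi.XiBound :=
  xiBound_of_parts stub_ratioControl stub_exponentProduct stub_eisensteinPartMax
    stub_nonEisensteinPartMax

/-- Wiring check: the conclusion of `xiBound_of_parts` is the route decl (definitionally), so the
four NAMED statements imply the crux with no `sorry` at all. -/
example (h1 : RatioControl) (h2 : ExponentProductBound) (h3 : EisensteinPartMax)
    (h4 : NonEisensteinPartMax) : Summit.ABC.ABC.Theses.DefiniteXi.XiBound :=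
  xiBound_of_parts h1 h2 h3 h4

/-! ### Converses: both OPEN stubs are implied by the crux (PROVED) — they are necessary -/

/-- Arithmetic of the converses: from `x ≤ y + 1`, `y ≤ C N^A`, `N ≥ 1` to
`x ≤ (max C 0 + 1) N^{max A 0}`. -/
theorem le_succ_bound {x y N C A : ℝ} (hN : 1 ≤ N) (hxy : x ≤ y + 1) (hy : y ≤ C * N ^ A) :
    x ≤ (max C 0 + 1) * N ^ (max A 0) := by
  have hN0 : 0 < N := one_pos.trans_le hN
  have h1 : (1 : ℝ) ≤ N ^ (max A 0) := Real.one_le_rpow hN (le_max_right _ _)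
  have h2 : N ^ A ≤ N ^ (max A 0) := Real.rpow_le_rpow_of_exponent_le hN (le_max_left _ _)
  have h3 : C * N ^ A ≤ max C 0 * N ^ (max A 0) :=
    calc C * N ^ A ≤ max C 0 * N ^ A :=
          mul_le_mul_of_nonneg_right (le_max_left _ _) (Real.rpow_nonneg hN0.le _)
      _ ≤ max C 0 * N ^ (max A 0) := mul_le_mul_of_nonneg_left h2 (le_max_right _ _)
  calc x ≤ y + 1 := hxy
    _ ≤ max C 0 * N ^ (max A 0) + 1 * N ^ (max A 0) := by
        apply add_le_add (hy.trans h3)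
        rw [one_mul]; exact h1
    _ = (max C 0 + 1) * N ^ (max A 0) := by ring

/-- `sixPart ξ ≤ ξ + 1` (`≤ ξ` for `ξ ≠ 0`, `= 1` for `ξ = 0`). -/
theorem sixPart_le_succ (ξ : ℕ) : sixPart ξ ≤ ξ + 1 := by
  rcases eq_or_ne ξ 0 with rfl | hξ
  · simp [sixPart]
  · exact (Nat.le_of_dvd (Nat.pos_of_ne_zero hξ) (sixPart_dvd ξ)).trans (Nat.le_succ ξ)

/-- **The crux implies STUB 3** (apply `XiBound` at the maximal type; `sixPart ξ ≤ ξ + 1`). -/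
theorem eisensteinPartMax_of_xiBound (h : Summit.ABC.ABC.Theses.DefiniteXi.XiBound) :
    EisensteinPartMax := by
  obtain ⟨A, C, H⟩ := h
  refine ⟨max A 0, max C 0 + 1, fun a b hab h0 N _ hN M hMo hMs hMc hMN _ => ?_⟩
  have hN1 : (1 : ℝ) ≤ N := by exact_mod_cast Nat.one_le_iff_ne_zero.mpr (NeZero.ne N)
  have e := H a b hab h0 N hN M hMo hMs hMc hMN
  set ξ : ℕ := brandtXi (N / M) M fun n => (freyCurve a b).LFunction n
  have h6 : ((sixPart ξ : ℕ) : ℝ) ≤ (ξ : ℝ) + 1 := by exact_mod_cast sixPart_le_succ ξ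
  exact le_succ_bound hN1 h6 e

/-- **The crux implies STUB 4** (apply `XiBound` at the maximal type; `ξ / sixPart ξ ≤ ξ`). -/
theorem nonEisensteinPartMax_of_xiBound (h : Summit.ABC.ABC.Theses.DefiniteXi.XiBound) :
    NonEisensteinPartMax := by
  obtain ⟨A, C, H⟩ := h
  refine ⟨max A 0, max C 0 + 1, fun a b hab h0 N _ hN M hMo hMs hMc hMN _ => ?_⟩
  have hN1 : (1 : ℝ) ≤ N := by exact_mod_cast Nat.one_le_iff_ne_zero.mpr (NeZero.ne N)
  have e := H a b hab h0 N hN M hMo hMs hMc hMN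
  set ξ : ℕ := brandtXi (N / M) M fun n => (freyCurve a b).LFunction n
  have h7 : ξ / sixPart ξ ≤ ξ + 1 := (Nat.div_le_self _ _).trans (Nat.le_succ _)
  have h7r : ((ξ / sixPart ξ : ℕ) : ℝ) ≤ (ξ : ℝ) + 1 := by exact_mod_cast h7
  exact le_succ_bound hN1 h7r e

/-- Position of the line, kernel-checked: modulo the two KNOWN-type stubs (1, 2) the crux is
EQUIVALENT to the conjunction of the two open stubs (3, 4). -/
theorem xiBound_iff_parts (h1 : RatioControl) (h2 : ExponentProductBound) :
    Summit.ABC.ABC.Theses.DefiniteXi.XiBound ↔ EisensteinPartMax ∧ NonEisensteinPartMax :=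
  ⟨fun h => ⟨eisensteinPartMax_of_xiBound h, nonEisensteinPartMax_of_xiBound h⟩,
    fun h => xiBound_of_parts h1 h2 h.1 h.2⟩

/-! ### Disproof used — landed Negative lemmas the stubs are checked against (examples) -/

/-- (DomainSetup) Every stub is stated with `brandtXi`; a prover may compute it in ANY Brandt setup
of the type (`Negative.brandtXi_freyCurve_eq_xi`, from the tree's setup independence). -/
example {Np Nm : ℕ} (S : Brandt.XiSetup Np Nm) (a b : ℤ) :
    brandtXi Np Nm (lam a b) = S.xi (lam a b) :=
  Summit.ABC.ABC.Theorems.XiBound.Negative.brandtXi_freyCurve_eq_xi S a b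

/-- (DomainSetup) On the crux's domain the maximal type produced by `exists_maxType` is admissible,
hence setup-backed: `ξ_max` in STUBS 3/4 is a genuine congruence number, never the junk `0` of a
missing setup (`Negative.nonempty_xiSetup_freyCurve`). -/
example {a b : ℤ} (hab : IsCoprime a b) (h0 : a * b * (a + b) ≠ 0) {Nm : ℕ} (hodd : Odd Nm)
    (hsq : Squarefree Nm) (hcard : Odd Nm.primeFactors.card)
    (hdvd : Nm ∣ (freyCurve a b).conductorNorm ℤ) :
    ∃ M : ℕ, Nm ∣ M ∧ IsMaxType ((freyCurve a b).conductorNorm ℤ) M ∧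
      Nonempty (Brandt.XiSetup ((freyCurve a b).conductorNorm ℤ / M) M) := by
  haveI := isElliptic_freyCurve h0
  have hN : (freyCurve a b).conductorNorm ℤ ≠ 0 := (WeierstrassCurve.conductorNorm_pos_holds _).ne'
  obtain ⟨M, hMo, hMs, hMc, hMN, hMmax, hNmM⟩ := exists_maxType hN hodd hsq hcard hdvd
  exact ⟨M, hNmM, hMmax,
    Summit.ABC.ABC.Theorems.XiBound.Negative.nonempty_xiSetup_freyCurve hab h0 hMo hMs hMc hMN⟩

/-- (ValueGap) Harmless here: the honest values of `ξ_max` start at `2`. -/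
example (Np Nm : ℕ) {a b : ℤ} (h0 : a * b * (a + b) ≠ 0) : brandtXi Np Nm (lam a b) ≠ 1 := by
  haveI := isElliptic_freyCurve h0
  exact Summit.ABC.ABC.Theorems.XiBound.Negative.brandtXi_lFunction_ne_one Np Nm (freyCurve a b)

end Summit.ABC.ABC.Cruxes.XiBound.MaxQuarantineReduction

end
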